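import Summits.QuantumFields.YangMills.Theorems.LuscherReductionTwistedTraceScalingOrthoTransverseRotation
import Summits.QuantumFields.YangMills.Theorems.LuscherReductionTwistedTraceScalingStiffTrialMeasurable
import Literature.MathematicalPhysics.QuantumFieldTheory.StrongCouplingActivities
import HarnessLib

/-!
# The transverse measure of the orthographic tube is EVEN: `π` is invariant under the fibre reflection `ι : v ↦ −v`
# (rate twin of `stub_boRate`, crux K1 `NearFlatRatioLaw` stmt-QuantumFields-24720, line «borate»; chart of route RED lane A, COARSE-DESIGN §23)

The rate-twin toolkit (`Cruxes/NearFlatRatioLaw/Lines/borate-rate-toolkit-g7.md`) removes every first-order true-vs-model term of the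
gauge-averaged kernel that is ODD under the fibre reflection `ι : w ↦ −w` (`KernelParity.abs_form_sub_le_of_kernel_near_odd`,
`KernelParity.integral_prod_eq_zero_of_odd`); those lemmas take as input that `ι` PRESERVES the fibre measure.  The fibre measure of lane A's
orthographic tube chart is `π = orthoTransverse L` (`…SlowDisintegrationTubes`: the `v`-marginal of the a-priori measure pulled back along
`(u, v) ↦ orthoTube L u⁻¹ v`, `v` capped balanced).  This file proves the chart fact

  ★★★ `orthoTransverse_map_neg`: `(orthoTransverse L).map (fun v => −v) = orthoTransverse L`, and
  ★★★ `integral_orthoTransverse_neg`: `∫ g(−v) dπ(v) = ∫ g(v) dπ(v)` for measurable `g`.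

Mechanism (template: `orthoTransverse_map_colourRotate`, p625418).  Link inversion `U ↦ U⁻¹` preserves the product Haar measure and maps the tube to
itself: `(chartSU2 v · u_k)⁻¹ = u_k⁻¹ · chartSU2(−v) = chartSU2(Ad(u_k⁻¹)(−v)) · u_k⁻¹` (`chartSU2_neg`, `chartSU2_adRot`), i.e. in chart coordinates it is the
involution `J : (u, v) ↦ (u⁻¹, colourRotate (k ↦ u_k) (−v))` of the tube domain (inside the proof of `orthoTransverse_map_neg`).  Its fibre action is a reflection
followed by a `u`-DEPENDENT colour rotation; since the pulled-back measure is the product `σ^{⊗3} ⊗ π` (`slowMeasure_eq_prod`) and `π` is invariant under every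
FIXED colour rotation (`orthoTransverse_map_colourRotate`), Fubini removes the rotation fibre by fibre and the reflection invariance of `π` remains.
HONEST FRAMING: exact measure bookkeeping (no kernel estimate) for the rate twin of a registered stub of crux K1 of the CONDITIONAL reduction route
`FlatTubeReduction` (R2b1 RECORD-label femto rung, fixed lattice `(ℤ/L)³`, `β → ∞`); `stub_boRate` itself is untouched; not infinite volume, not a mass gap, not Clay.
-/

set_option autoImplicit false

noncomputable section

open MeasureTheory Filter Topology Real
open scoped BigOperators Matrix
open Literature.MathematicalPhysics.QuantumFieldTheory
open Literature.MathematicalPhysics.QuantumLattice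

namespace Summit.QuantumFields.YangMills.Theorems.FemtoTransferGap.TwoLattice.ConstTube

open Summit.QuantumFields.YangMills.Theorems.FemtoTransferGap
open Summit.QuantumFields.YangMills.Theorems.FemtoTransferGap.TwoLattice.SlowChart
open Summit.QuantumFields.YangMills.Theorems.FemtoTransferGap.TwoLattice.Cov (adRot_mul adRot_one sum_sq_adRot_mulVec scalarPart_inv vecPart_inv)

variable (L : ℕ) [NeZero L]

/-! ## §1 Reflection of the chart coordinate is link inversion up to a colour rotation -/

/-- `chartSU2 (−x) = (chartSU2 x)⁻¹` on the closed unit ball (same scalar part, opposite vector part). [cite: BrockerTomDieck1985, I (1.10)] -/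
theorem chartSU2_neg {x : Fin 3 → ℝ} (hx : ∑ a, x a ^ 2 ≤ 1) : chartSU2 (-x) = (chartSU2 x)⁻¹ := by
  have hx' : ∑ a, (-x) a ^ 2 ≤ 1 := by simpa only [Pi.neg_apply, neg_sq] using hx
  refine eq_of_scalarPart_eq_of_vecPart_eq ?_ ?_
  · rw [scalarPart_chartSU2 hx', scalarPart_inv, scalarPart_chartSU2 hx]
    simp only [Pi.neg_apply, neg_sq]
  · rw [vecPart_chartSU2 hx', vecPart_inv, vecPart_chartSU2 hx]

omit [NeZero L] in
/-- Colour rotations are linear: `colourRotate r (−v) = −colourRotate r v`. [folklore] -/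
theorem colourRotate_neg (r : Fin 3 → SU2) (v : Edge 3 L → Fin 3 → ℝ) : colourRotate L r (-v) = -colourRotate L r v := by
  funext e; simp only [colourRotate, Pi.neg_apply, Matrix.mulVec_neg]

omit [NeZero L] in
/-- ★ **Link inversion of the orthographic tube is a reflection of the fibre followed by a colour rotation, over the inverted slow variable**:
`(orthoTube u v)⁻¹ = orthoTube u⁻¹ (colourRotate (k ↦ u_k⁻¹) (−v))` on the cap. [folklore] -/
theorem orthoTube_inv (u : GaugeConfig 3 1 SU2) {v : Edge 3 L → Fin 3 → ℝ} (hv : ∀ e : Edge 3 L, ∑ a, v e a ^ 2 ≤ 1) :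
    (orthoTube L u v)⁻¹ = orthoTube L u⁻¹ (colourRotate L (fun k => (u (0, k))⁻¹) (-v)) := by
  funext e
  have hve : ∑ a, (-v e) a ^ 2 ≤ 1 := by simpa only [Pi.neg_apply, neg_sq] using hv e
  have hneg : (-v) e = -v e := rfl
  simp only [Pi.inv_apply, orthoTube_apply, colourRotate, hneg]
  rw [mul_inv_rev, ← chartSU2_neg (hv e), chartSU2_adRot _ hve]
  simp only [mul_assoc, inv_mul_cancel, mul_one]

/-- The `u`-dependent colour rotation `(u, v) ↦ colourRotate (k ↦ u_k) v` of the tube domain is jointly measurable. [folklore] -/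
theorem measurable_colourRotate_dir :
    Measurable fun p : GaugeConfig 3 1 SU2 × capBalancedSet L => colourRotate L (fun k => p.1 (0, k)) (p.2 : Edge 3 L → Fin 3 → ℝ) := by
  refine measurable_pi_lambda _ fun e => measurable_pi_lambda _ fun a => ?_
  simp only [colourRotate, Matrix.mulVec, dotProduct]
  refine Finset.measurable_sum _ fun b _ => ?_
  have h1 : Measurable fun p : GaugeConfig 3 1 SU2 × capBalancedSet L => adRot (p.1 (0, e.2)) a b :=
    ((continuous_adRot.matrix_elem a b).measurable).comp ((measurable_pi_apply _).comp measurable_fst)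
  have h2 : Measurable fun p : GaugeConfig 3 1 SU2 × capBalancedSet L => (p.2 : Edge 3 L → Fin 3 → ℝ) e b :=
    (measurable_pi_apply b).comp ((measurable_pi_apply e).comp (measurable_subtype_coe.comp measurable_snd))
  exact h1.mul h2

/-- The `u`-dependent reflected colour rotation `(u, v) ↦ colourRotate (k ↦ u_k) (−v)` is jointly measurable. [folklore] -/
theorem measurable_colourRotate_dir_neg :
    Measurable fun p : GaugeConfig 3 1 SU2 × capBalancedSet L => colourRotate L (fun k => p.1 (0, k)) (-(p.2 : Edge 3 L → Fin 3 → ℝ)) := by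
  have h : (fun p : GaugeConfig 3 1 SU2 × capBalancedSet L => colourRotate L (fun k => p.1 (0, k)) (-(p.2 : Edge 3 L → Fin 3 → ℝ))) =
      fun p => -colourRotate L (fun k => p.1 (0, k)) (p.2 : Edge 3 L → Fin 3 → ℝ) := by
    funext p; exact colourRotate_neg L _ _
  rw [h]
  exact (measurable_colourRotate_dir L).neg

/-! ## §2 ★★★ The transverse measure is even -/

/-- ★★★ **THE TRANSVERSE MEASURE IS INVARIANT UNDER THE FIBRE REFLECTION**: `(orthoTransverse L).map (fun v => −v) = orthoTransverse L`.
Link inversion preserves the product Haar measure and acts on the tube domain as the involution `J (u, v) = (u⁻¹, colourRotate (k ↦ u_k) (−v))`, so the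
pulled-back measure is `J`-invariant; the product structure `σ^{⊗3} ⊗ π` (`slowMeasure_eq_prod`) and the invariance of `π` under each FIXED colour rotation
(`orthoTransverse_map_colourRotate`) remove the `u`-dependent rotation fibre by fibre (Fubini), leaving reflection invariance. [folklore] -/
theorem orthoTransverse_map_neg : (orthoTransverse L).map (fun v => -v) = orthoTransverse L := by
  haveI : PolishSpace (capBalancedSet L) := (isClosed_capBalancedSet L).polishSpace
  haveI := isFiniteMeasure_slowMarginal (continuous_orthoChart L) (orthoChart_injective L)
  haveI : (configMeasure SU2 L).IsInvInvariant := by unfold configMeasure; infer_instance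
  have hnegm : Measurable fun v : Edge 3 L → Fin 3 → ℝ => -v := measurable_neg
  -- negation preserves the capped balanced set (cf. `TwistedTraceScaling.Negative.R33.neg_mem_capBalancedSet`)
  have hnegcap : ∀ v : capBalancedSet L, -(v : Edge 3 L → Fin 3 → ℝ) ∈ capBalancedSet L := fun v =>
    ⟨fun k a => by simp only [Pi.neg_apply, Finset.sum_neg_distrib, v.2.1 k a, neg_zero],
      fun e => by simpa only [Pi.neg_apply, neg_sq] using v.2.2 e⟩
  -- §a the inversion map `J` of the tube domain
  set J : GaugeConfig 3 1 SU2 × capBalancedSet L → GaugeConfig 3 1 SU2 × capBalancedSet L := fun p =>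
    (p.1⁻¹, ⟨colourRotate L (fun k => p.1 (0, k)) (-(p.2 : Edge 3 L → Fin 3 → ℝ)),
      colourRotate_mem_capBalancedSet L (hnegcap p.2)⟩) with hJ
  have hJm : Measurable J := measurable_fst.inv.prodMk (measurable_colourRotate_dir_neg L).subtype_mk
  -- under the slow embedding `J` is link inversion
  have hJemb : ∀ p, slowEmb (orthoChart L) (J p) = (slowEmb (orthoChart L) p)⁻¹ := fun p => by
    simp only [hJ, slowEmb, orthoChart]
    rw [orthoTube_inv L _ (fun e => sum_sq_le_one_of_cap L p.2.2.2 e)]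
    simp only [inv_inv, Pi.inv_apply]
  -- `J` is an involution
  have hJJ : ∀ p, J (J p) = p := fun p => by
    refine Prod.ext (by simp only [hJ, inv_inv]) (Subtype.ext ?_)
    simp only [hJ]
    have hr : ((fun k => (p.1)⁻¹ (0, k)) * fun k => p.1 (0, k)) = (1 : Fin 3 → SU2) := by
      funext k; simp only [Pi.mul_apply, Pi.inv_apply, inv_mul_cancel, Pi.one_apply]
    rw [colourRotate_neg L (fun k => p.1 (0, k)), neg_neg, colourRotate_mul, hr, colourRotate_one]
  -- images of `J`-preimages are inverses of images
  have himg : ∀ s : Set (GaugeConfig 3 1 SU2 × capBalancedSet L),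
      slowEmb (orthoChart L) '' (J ⁻¹' s) = Inv.inv ⁻¹' (slowEmb (orthoChart L) '' s) := fun s => by
    ext U
    simp only [Set.mem_image, Set.mem_preimage]
    constructor
    · rintro ⟨p, hp, rfl⟩
      exact ⟨J p, hp, hJemb p⟩
    · rintro ⟨q, hq, hqU⟩
      refine ⟨J q, by rw [hJJ]; exact hq, ?_⟩
      rw [hJemb, hqU, inv_inv]
  -- §b ★ the pulled-back measure is `J`-invariant (inversion invariance of the product Haar measure)
  have hJinv : (slowMeasure (orthoChart L)).map J = slowMeasure (orthoChart L) := by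
    ext s hs
    rw [Measure.map_apply hJm hs, slowMeasure_apply (continuous_orthoChart L) (orthoChart_injective L),
      slowMeasure_apply (continuous_orthoChart L) (orthoChart_injective L), himg, Measure.measure_preimage_inv]
  -- §c cylinder sets
  have hcyl : ∀ {B : Set (Edge 3 L → Fin 3 → ℝ)}, MeasurableSet B →
      orthoTransverse L B = slowMeasure (orthoChart L) (Prod.snd ⁻¹' (Subtype.val ⁻¹' B)) := fun {B} hB => by
    rw [orthoTransverse, Measure.map_apply measurable_subtype_coe hB, slowMarginal, Measure.map_apply measurable_snd (measurable_subtype_coe hB)]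
  ext A hA
  rw [Measure.map_apply hnegm hA]
  set S1 : Set (GaugeConfig 3 1 SU2 × capBalancedSet L) := Prod.snd ⁻¹' (Subtype.val ⁻¹' ((fun v : Edge 3 L → Fin 3 → ℝ => -v) ⁻¹' A)) with hS1def
  set S2 : Set (GaugeConfig 3 1 SU2 × capBalancedSet L) :=
    {p | colourRotate L (fun k => p.1 (0, k)) (p.2 : Edge 3 L → Fin 3 → ℝ) ∈ A} with hS2def
  have hS1 : MeasurableSet S1 := measurable_snd (measurable_subtype_coe (hnegm hA))
  have hS2 : MeasurableSet S2 := measurable_colourRotate_dir L hA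
  have hset : J ⁻¹' S1 = S2 := by
    ext p
    simp only [hS1def, hS2def, hJ, Set.mem_preimage, Set.mem_setOf_eq, colourRotate_neg, neg_neg]
  -- §d fibre by fibre the section of `S2` over `u` is a rotated copy of `A`, of the same `π`-measure
  have hfib : ∀ u : GaugeConfig 3 1 SU2, slowMarginal (orthoChart L) (Prod.mk u ⁻¹' S2) = orthoTransverse L A := fun u => by
    have hsec : Prod.mk u ⁻¹' S2 = Subtype.val ⁻¹' (colourRotate L (fun k => u (0, k)) ⁻¹' A) := rfl
    rw [hsec, ← Measure.map_apply measurable_subtype_coe (measurable_colourRotate L _ hA)]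
    show orthoTransverse L (colourRotate L (fun k => u (0, k)) ⁻¹' A) = orthoTransverse L A
    rw [← Measure.map_apply (measurable_colourRotate L _) hA, orthoTransverse_map_colourRotate]
  calc orthoTransverse L ((fun v : Edge 3 L → Fin 3 → ℝ => -v) ⁻¹' A)
      = slowMeasure (orthoChart L) S1 := hcyl (hnegm hA)
    _ = (slowMeasure (orthoChart L)).map J S1 := by rw [hJinv]
    _ = slowMeasure (orthoChart L) S2 := by rw [Measure.map_apply hJm hS1, hset]
    _ = ∫⁻ u, slowMarginal (orthoChart L) (Prod.mk u ⁻¹' S2) ∂configMeasure SU2 1 := by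
        rw [slowMeasure_eq_prod (continuous_orthoChart L) (orthoChart_injective L) (orthoChart_mul L), Measure.prod_apply hS2]
    _ = ∫⁻ _u, orthoTransverse L A ∂configMeasure SU2 1 := lintegral_congr fun u => hfib u
    _ = orthoTransverse L A := by rw [lintegral_const, measure_univ, mul_one]

/-- ★★★ The fibre reflection `v ↦ −v` is a MEASURE-PRESERVING equivalence of `(ℝ³)^E` for the transverse measure — the hypothesis `hι` of
`KernelParity.integral_prod_eq_zero_of_odd` / `KernelParity.abs_form_sub_le_of_kernel_near_odd` for `ι = MeasurableEquiv.neg _`. [folklore] -/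
theorem measurePreserving_neg_orthoTransverse :
    MeasurePreserving (MeasurableEquiv.neg (Edge 3 L → Fin 3 → ℝ)) (orthoTransverse L) (orthoTransverse L) :=
  ⟨(MeasurableEquiv.neg _).measurable, orthoTransverse_map_neg L⟩

/-- ★★★ **Integration against the reflected transverse coordinate**: `∫ g(−v) dπ(v) = ∫ g(v) dπ(v)` (any `g`; change of variables along a
measurable equivalence). [folklore] -/
theorem integral_orthoTransverse_neg (g : (Edge 3 L → Fin 3 → ℝ) → ℝ) :
    ∫ v, g (-v) ∂orthoTransverse L = ∫ v, g v ∂orthoTransverse L :=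
  (measurePreserving_neg_orthoTransverse L).integral_comp' g

end Summit.QuantumFields.YangMills.Theorems.FemtoTransferGap.TwoLattice.ConstTube

end
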